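import Summits.ResolutionOfSingularities.ResolutionOfSingularities.Theorems.HomologicalConductorNoZenoSannSplitting
import HarnessLib

/-!
# Crux `NoZenoR` (stmt-ResolutionOfSingularities-19943), row 8⁗ — the PULLBACK OF A COVER SEQUENCE ALONG A
# HOMOTHETY (the comparison morphism left as a hypothesis in `…NoZenoSannSplitting`)

Route `ResolutionOfSingularities/HomologicalConductor`, chain W4.4, KERNEL-g17 §6.1 (lead g17). `[OURS]` —
AI-formalised, weaker than expert review; NOT a statement of any manuscript under review.

For a short exact `S : 0 → X₁ —f→ X₂ —g→ X₃ → 0` in an `R`-linear abelian category and `x : R`, the pullback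
of `S` along the homothety `x • 𝟙 X₃` is the short complex
`T : 0 → X₁ → X₂ ×_{X₃} X₃ → X₃ → 0` (`homothetyPullback`), with the comparison morphism
`φ = (𝟙, pr₁, x • 𝟙) : T ⟶ S` (`homothetyPullbackHom`). We prove `T` is short exact
(`homothetyPullback_shortExact`: `T.f` is a kernel of `T.g` by the universal properties of the kernel
`f` of `g` and of the pullback; `T.g` is an epimorphism as the pullback of the epimorphism `g`), and
conclude with `…NoZenoSannSplitting`: **`T` splits iff `x • [S] = 0` iff `x • 𝟙 X₃` lifts along `g`**
(`homothetyPullback_splitting_iff`, `…_iff_exists_lift`). Model (KERNEL-g17 LEMMA 6.1): `S` the minimal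
cover `0 → ΩN → P → N → 0`, `x ∈ 𝔪` regular on `N`; then `X₂ ×_N N = {p : π p ∈ xN} = Ω(N/xN)` and the
statement reads «`Ω(N/xN) ≅ N ⊕ ΩN` iff `x ∈ sann(N)`» — the step iterated along a minimal reduction in
PROP 6.2, whence THEOREM 17.1 (`ca(⅟5(1,3,2)) ⊆ TR`, `y₂y₃ ∉ ca`). The identification of the pullback with
`Ω(N/xN)` (a statement about minimal covers over a local ring) is not typed here.
-/

noncomputable section

-- single-problem summit: the doubled namespace component is forced
set_option linter.dupNamespace false

open CategoryTheory CategoryTheory.Abelian CategoryTheory.Limits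
open Literature.RingTheory.CohomologyAnnihilator
open Summit.ResolutionOfSingularities.ResolutionOfSingularities.Theorems.NoZeno.SannSplitting

universe w t v u

namespace Summit.ResolutionOfSingularities.ResolutionOfSingularities.Theorems.NoZeno.HomothetyPullback

variable {R : Type t} [Ring R] {C : Type u} [Category.{v} C] [Abelian C] [Linear R C]

/-- The pullback of a short complex `0 → X₁ → X₂ → X₃ → 0` (with `f ≫ g = 0`) along the homothety
`x • 𝟙 X₃`: `0 → X₁ → X₂ ×_{X₃} X₃ → X₃ → 0`. [this work; KERNEL-g17 §6.1] -/
abbrev homothetyPullback (S : ShortComplex C) (x : R) : ShortComplex C :=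
  ShortComplex.mk (pullback.lift S.f (0 : S.X₁ ⟶ S.X₃) (by rw [S.zero, zero_comp]))
    (pullback.snd S.g (x • 𝟙 S.X₃)) (by rw [pullback.lift_snd])

/-- The comparison morphism `(𝟙, pr₁, x • 𝟙)` from the homothety pullback to the original complex.
[this work] -/
def homothetyPullbackHom (S : ShortComplex C) (x : R) : homothetyPullback S x ⟶ S where
  τ₁ := 𝟙 S.X₁
  τ₂ := pullback.fst S.g (x • 𝟙 S.X₃)
  τ₃ := x • 𝟙 S.X₃
  comm₁₂ := by
    change 𝟙 S.X₁ ≫ S.f = pullback.lift S.f 0 _ ≫ pullback.fst S.g (x • 𝟙 S.X₃)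
    rw [Category.id_comp, pullback.lift_fst]
  comm₂₃ := pullback.condition

/-- The first component of the comparison morphism is the identity. [this work] -/
@[simp] theorem homothetyPullbackHom_τ₁ (S : ShortComplex C) (x : R) :
    (homothetyPullbackHom S x).τ₁ = 𝟙 S.X₁ := rfl

/-- The third component of the comparison morphism is the homothety `x • 𝟙`. [this work] -/
@[simp] theorem homothetyPullbackHom_τ₃ (S : ShortComplex C) (x : R) :
    (homothetyPullbackHom S x).τ₃ = x • 𝟙 S.X₃ := rfl

/-- The first component of the comparison morphism is an isomorphism (it is the identity); stated as a
theorem (used via `haveI`), not as an instance. [this work] -/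
theorem isIso_homothetyPullbackHom_τ₁ (S : ShortComplex C) (x : R) :
    IsIso (homothetyPullbackHom S x).τ₁ := by
  change IsIso (𝟙 S.X₁)
  infer_instance

/-- **The homothety pullback of a short exact sequence is short exact.** `T.g = pr₂` is an epimorphism
(pullback of the epimorphism `S.g` in an abelian category) and `T.f` is a kernel of `T.g`: a morphism
`z` with `z ≫ pr₂ = 0` has `(z ≫ pr₁) ≫ S.g = 0`, so `z ≫ pr₁` factors through the kernel `S.f` of `S.g`,
and the factorisation lifts to the pullback by its universal property. [this work] -/
theorem homothetyPullback_shortExact {S : ShortComplex C} (hS : S.ShortExact) (x : R) :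
    (homothetyPullback S x).ShortExact := by
  haveI := hS.mono_f
  haveI := hS.epi_g
  have hmono : Mono (homothetyPullback S x).f :=
    mono_of_mono_fac (pullback.lift_fst S.f (0 : S.X₁ ⟶ S.X₃) (by rw [S.zero, zero_comp]))
  have hepi : Epi (homothetyPullback S x).g :=
    (inferInstance : Epi (pullback.snd S.g (x • 𝟙 S.X₃)))
  -- the lift of a morphism killing `pr₂` through `S.f`, via the kernel property of `S.f`
  have hker : ∀ {W' : C} (z : W' ⟶ pullback S.g (x • 𝟙 S.X₃)),
      z ≫ pullback.snd S.g (x • 𝟙 S.X₃) = 0 → (z ≫ pullback.fst S.g (x • 𝟙 S.X₃)) ≫ S.g = 0 := by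
    intro W' z hz
    rw [Category.assoc, pullback.condition, ← Category.assoc, hz, zero_comp]
  refine ShortComplex.ShortExact.mk' ?_ hmono hepi
  refine ShortComplex.exact_of_f_is_kernel _ (KernelFork.IsLimit.ofι _ _
    (fun z hz => hS.fIsKernel.lift (KernelFork.ofι _ (hker z hz)))
    (fun z hz => ?_) (fun z hz m hm => ?_))
  · apply pullback.hom_ext
    · rw [Category.assoc, pullback.lift_fst]
      exact hS.fIsKernel.fac (KernelFork.ofι _ (hker z hz)) WalkingParallelPair.zero
    · rw [Category.assoc, pullback.lift_snd, comp_zero, hz]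
  · haveI := hmono
    rw [← cancel_mono (homothetyPullback S x).f, hm]
    symm
    apply pullback.hom_ext
    · rw [Category.assoc, pullback.lift_fst]
      exact hS.fIsKernel.fac (KernelFork.ofι _ (hker z hz)) WalkingParallelPair.zero
    · rw [Category.assoc, pullback.lift_snd, comp_zero, hz]

variable [HasExt.{w} C]

/-- **LEMMA 6.1 (categorical, with the pullback constructed).** For `S` short exact and `x : R`, the
homothety pullback `T` of `S` splits iff `x • [S] = 0`. Model: `Ω(N/xN) ≅ N ⊕ ΩN ⟺ x · ξ_N = 0`.
[this work; KERNEL-g17 §6.1] -/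
theorem homothetyPullback_splitting_iff {S : ShortComplex C} (hS : S.ShortExact) (x : R) :
    Nonempty (homothetyPullback S x).Splitting ↔ x • hS.extClass = 0 := by
  haveI : IsIso (𝟙 S.X₃) := inferInstance
  haveI := isIso_homothetyPullbackHom_τ₁ S x
  exact nonempty_splitting_iff_smul_extClass_eq_zero hS (homothetyPullback_shortExact hS x)
    (homothetyPullbackHom S x) (𝟙 S.X₃) rfl

/-- … iff the homothety `x • 𝟙 X₃` lifts along `S.g` — «`x` stably annihilates `X₃` through `X₂`»;
when `X₂` is a projective cover of `X₃` this is `x ∈ sann(X₃)`. [this work; KERNEL-g17 §6.1] -/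
theorem homothetyPullback_splitting_iff_exists_lift {S : ShortComplex C} (hS : S.ShortExact)
    (x : R) :
    Nonempty (homothetyPullback S x).Splitting ↔ ∃ h : S.X₃ ⟶ S.X₂, h ≫ S.g = x • 𝟙 S.X₃ :=
  (homothetyPullback_splitting_iff hS x).trans (smul_extClass_eq_zero_iff_exists_lift hS)

/-- In particular, if `x • 𝟙 X₃` lifts along `S.g`, the middle term of the pullback is `X₁ ⊞ X₃`
(in the model: `Ω(N/xN) ≅ ΩN ⊕ N` for `x ∈ sann N`). [this work] -/
theorem nonempty_iso_biprod_of_exists_lift {S : ShortComplex C} (hS : S.ShortExact) (x : R)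
    (h : ∃ h : S.X₃ ⟶ S.X₂, h ≫ S.g = x • 𝟙 S.X₃) :
    Nonempty (pullback S.g (x • 𝟙 S.X₃) ≅ S.X₁ ⊞ S.X₃) := by
  obtain ⟨sp⟩ := (homothetyPullback_splitting_iff_exists_lift hS x).2 h
  exact ⟨sp.isoBinaryBiproduct⟩

end Summit.ResolutionOfSingularities.ResolutionOfSingularities.Theorems.NoZeno.HomothetyPullback

end
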